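import Mathlib
import Summits.NavierStokesRegularity.NavierStokesRegularity.Theorems.SubOnsagerCeilingKPSecondaryAssembly
import Summits.NavierStokesRegularity.NavierStokesRegularity.Theorems.SubOnsagerCeilingSideBranchWitness
import HarnessLib

/-!
# The conditional assembly on the side-branch witness table `α_SB`
(helper file for crux stmt-NavierStokesRegularity-27057 `SubOnsagerCeiling.ForwardTailCeilingKP`,
`--supports … --as helper`; LEAD SE seat ns-senv-p1 as KEY-NS #146 (1) / #147 (3) hands for LEAD SOC;
instance of `fwdCeilingKP_of_primaryEnvelope`, p651249)

`sideBranchTable` (`α_SB`, `Theorems/SubOnsagerCeilingDefs.lean`; the numerical witness against the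
TOTAL-energy ceiling 25507: chain on component `0`, in-shell side pump `x_0² → x_1` (`1/5`), feed
`x_1² → x_2'` (`1/5`) into the dead-end pocket `2`) is a KP network proper whose forward sources are
`S⁺ = {0, 1}`; with the primary set `P = {0}` (the chain) the structural clauses of the assembly hold:
the side source `1` has no feeder from below, its only in-shell partner is the chain mode `0 ∈ P`, and
its target `2` feeds nothing and pumps nothing (`sideBranch_structural`). Hence
(`sideBranch_fwdCeilingKP_of_chainBarrier`): a ν-uniform `θ`-shell barrier (`1/2 < θ ≤ 1`) of the CHAIN
MODE ALONE along the honest viscous solutions of `α_SB` implies the per-table body of the crux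
`ForwardTailCeilingKP` for `α_SB` (the skeleton's `FwdCeilingKPAt R ε₀ sideBranchTable`, verbatim), with
`S = S⁺(α_SB)` — the pocket needs no hypothesis and the side source is slaved. This pins what the
remaining S-prim input must deliver on the witness class: the chain envelope ROBUST TO THE SIDE DRAIN
`−(1/5)Λ_k x_{0,k} x_{1,k}` (LEAD SOC census v6 §A (ii): a joint region), nothing about modes `1, 2`.

HONEST FRAMING: a conditional statement about one explicit Tao-type MODEL lattice table (rung
TL-M2Break, route SubOnsagerCeiling); not a proof of the crux and not a statement about the aside 25507
(whose TOTAL-energy ceiling counts the pocket); nothing here bears on Navier–Stokes regularity.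
-/

noncomputable section

-- the sub-problem namespace `NavierStokesRegularity.NavierStokesRegularity` is the tree's layout (D-0017)
set_option linter.dupNamespace false

namespace Summit.NavierStokesRegularity.NavierStokesRegularity.Theorems

open Set Finset
open Literature.Analysis.FluidPDE.TaoCascade
open Summit.NavierStokesRegularity.NavierStokesRegularity.Theorems.SubOnsagerCeiling

/-- **Structural clauses (F), (Q), (T) for `α_SB` with primary set `{0}`.** Every forward source of
`sideBranchTable` other than the chain mode `0` — i.e. the side source `1` — is fed by no feed from
below, has the chain mode as its only in-shell partner, and has the dead-end pocket `2` as a target with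
no feed targets and no in-shell pumps. [this file] -/
theorem sideBranch_structural :
    ∀ a : Fin 4, a ∉ ({0} : Finset (Fin 4)) → (∃ e, sideBranchTable a a e (0, 0, 1) ≠ 0) →
      (∀ j, sideBranchTable j j a (0, 0, 1) ≠ 0 → j ∈ ({0} : Finset (Fin 4))) ∧
      (∀ i₁ i₂, i₁ ≠ a → i₂ ≠ a → sideBranchTable i₁ i₂ a (0, 0, 0) ≠ 0 →
        i₁ ∈ ({0} : Finset (Fin 4)) ∧ i₂ ∈ ({0} : Finset (Fin 4))) ∧
      (∃ e, sideBranchTable a a e (0, 0, 1) ≠ 0 ∧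
        (∀ j, sideBranchTable e e j (0, 0, 1) ≠ 0 → j ∈ ({0} : Finset (Fin 4))) ∧
        (∀ j, j ≠ e → sideBranchTable e e j (0, 0, 0) ≠ 0 → j ∈ ({0} : Finset (Fin 4)))) := by
  intro a ha hsrc
  -- the only source outside `{0}` is `a = 1`
  have ha1 : a = 1 := by
    obtain ⟨e, he⟩ := hsrc
    rw [sideBranchTable_feed] at he
    fin_cases a <;> fin_cases e <;> simp_all
  subst ha1
  refine ⟨?_, ?_, ⟨2, ?_, ?_, ?_⟩⟩
  · intro j hj
    rw [sideBranchTable_feed] at hj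
    fin_cases j <;> simp_all
  · intro i₁ i₂ h1 h2 h
    rw [sideBranchTable_inshell] at h
    fin_cases i₁ <;> fin_cases i₂ <;> simp_all
  · rw [sideBranchTable_feed]; simp
  · intro j hj
    rw [sideBranchTable_feed] at hj
    fin_cases j <;> simp_all
  · intro j hj2 hj
    rw [sideBranchTable_inshell] at hj
    fin_cases j <;> simp_all

/-- **On `α_SB`, a ν-uniform barrier of the CHAIN MODE alone gives the forward-source ceiling.** For
`R ≥ 1`, `0 < ε₀ ≤ 1`, `1/2 < θ ≤ 1` and any `D`: if along every honest `ν`-viscous solution of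
`sideBranchTable` from a one-shell datum the chain mode obeys `(1+ε₀)^{2θk}·½X_{0,k}(t)² ≤ D·E₀`
(all `k ≥ 0`, `t`, `ν`), then the per-table body of `ForwardTailCeilingKP` holds for
`(R, ε₀, sideBranchTable)` (= the skeleton's `FwdCeilingKPAt R ε₀ sideBranchTable`), with
`S = S⁺ = {0, 1}`, the same `θ` and `C = 1600R² max(D,1)/(1 − (1+ε₀)^{-2θ})`. MODEL lattice statement;
conditional. [this file] -/
theorem sideBranch_fwdCeilingKP_of_chainBarrier {R ε₀ θ D : ℝ}
    (hR : 1 ≤ R) (hε : 0 < ε₀) (hε1 : ε₀ ≤ 1) (hθ : 1 / 2 < θ) (hθ1 : θ ≤ 1)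
    (hchain : ∀ ν : ℝ, 0 < ν → ∀ (X₀ : Fin 4 → ℝ) (s : ℝ), 0 < s → ∀ X : Fin 4 → ℤ → ℝ → ℝ,
      (∀ (i : Fin 4) (k : ℤ), X i k 0 = if k = 0 then X₀ i else 0) →
      (∀ (i : Fin 4) (k : ℤ), k < 0 → ∀ t : ℝ, X i k t = 0) →
      (∃ M : ℝ, ∀ (t : ℝ) (i : Fin 4) (k : ℤ), (1 + (1 + ε₀) ^ ((10 : ℝ) * k)) * |X i k t| ≤ M) →
      (∀ (i : Fin 4) (k : ℤ), Continuous (X i k)) →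
      (∀ (i : Fin 4) (k : ℤ), ∀ t ∈ Set.Icc (0 : ℝ) s, HasDerivWithinAt (X i k)
        (quadTerm ε₀ sideBranchTable X i k t - ν * (1 + ε₀) ^ ((2 : ℝ) * k) * X i k t)
          (Set.Icc (0 : ℝ) s) t) →
      (∀ t ∈ Set.Icc (0 : ℝ) s, ∀ (i : Fin 4) (k : ℤ), 1 ≤ k → 0 ≤ X i k t) →
      ∀ t ∈ Set.Icc (0 : ℝ) s, ∀ k : ℕ,
        (1 + ε₀) ^ (2 * θ * (k : ℝ)) * ((1 / 2 : ℝ) * X 0 (k : ℤ) t ^ 2) ≤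
          D * (∑ j : Fin 4, (1 / 2 : ℝ) * X₀ j ^ 2)) :
    InTableClass R sideBranchTable →
    (∀ (Y : Fin 4 → ℤ → ℝ → ℝ) (τ : ℝ), (∀ (j : Fin 4) (k : ℤ), 1 ≤ k → 0 ≤ Y j k τ) →
      ∀ δ : ℝ, 0 < δ → ∀ (i : Fin 4) (n : ℤ), 1 ≤ n → Y i n τ = 0 →
        0 ≤ quadTerm δ sideBranchTable Y i n τ) →
    (∀ a b i : Fin 4, a ≠ b → sideBranchTable a b i (0, 0, 1) = 0) →
    ∃ S : Finset (Fin 4), (∀ i, i ∉ S → ∀ j l : Fin 4, sideBranchTable i j l (0, 0, 1) = 0) ∧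
      ∃ θ' : ℝ, 1 / 2 < θ' ∧ ∃ C : ℝ, 0 ≤ C ∧ ∀ ν : ℝ, 0 < ν → ∀ (X₀ : Fin 4 → ℝ) (s : ℝ), 0 < s →
      ∀ X : Fin 4 → ℤ → ℝ → ℝ,
      (∀ (i : Fin 4) (k : ℤ), X i k 0 = if k = 0 then X₀ i else 0) →
      (∀ (i : Fin 4) (k : ℤ), k < 0 → ∀ t : ℝ, X i k t = 0) →
      (∃ M : ℝ, ∀ (t : ℝ) (i : Fin 4) (k : ℤ), (1 + (1 + ε₀) ^ ((10 : ℝ) * k)) * |X i k t| ≤ M) →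
      (∀ (i : Fin 4) (k : ℤ), Continuous (X i k)) →
      (∀ (i : Fin 4) (k : ℤ), ∀ t ∈ Set.Icc (0 : ℝ) s, HasDerivWithinAt (X i k)
        (quadTerm ε₀ sideBranchTable X i k t - ν * (1 + ε₀) ^ ((2 : ℝ) * k) * X i k t)
          (Set.Icc (0 : ℝ) s) t) →
      (∀ t ∈ Set.Icc (0 : ℝ) s, ∀ (i : Fin 4) (k : ℤ), 1 ≤ k → 0 ≤ X i k t) →
      ∀ n N : ℕ, n ≤ N → ∀ t ∈ Set.Icc (0 : ℝ) s,
        ∑ k ∈ Finset.Icc n N, ∑ i ∈ S, (1 / 2 : ℝ) * X i (k : ℤ) t ^ 2 ≤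
          C * (∑ i : Fin 4, (1 / 2 : ℝ) * X₀ i ^ 2) * (1 + ε₀) ^ (-(2 * θ' * (n : ℝ))) :=
  fwdCeilingKP_of_primaryEnvelope ({0} : Finset (Fin 4)) hR hε hε1 hθ hθ1 sideBranch_structural
    (by
      intro ν hν X₀ s hs X hdat hlow hM hcont hder hnn t ht i hi k
      have hi0 : i = 0 := by simpa using hi
      subst hi0
      exact hchain ν hν X₀ s hs X hdat hlow hM hcont hder hnn t ht k)

end Summit.NavierStokesRegularity.NavierStokesRegularity.Theorems

end
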